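import Literature.Probability.LatticeModels.KilledWalkLaplacian
import HarnessLib

/-!
# Superlevel paths of killed-harmonic functions to the outer boundary (line
`symplectic-fermion-anchor`, crux `SAWLoopFugacityFlow.AvoidanceLimit`, stmt-CriticalPhenomena-10649)

The discrete maximum principle in PATH form for the edge-killed walk on a subgraph `Gr` of `ℤ²`
(walk along `Gr`-edges in the four lattice directions, killed at non-`Gr` steps and on leaving the
finite set `S`; `killedAvg`, `IsKilledHarmonicOn`, `killedOuterBoundary` of
`Literature/Probability/LatticeModels/KilledWalkLaplacian.lean`). A function `h` harmonic for the
killed walk on the finite set `S` with `h v > 0` at a site `v ∈ S` stays `≥ h v` along some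
`Gr`-walk from `v` to a site `w` of the outer boundary with `h w ≥ h v`: "superlevel sets of a
harmonic function are connected to where the boundary data is large". This is Chelkak's device
"`H(·) ≥ H(v_max)` along some path `γ` running from `v_max` to the boundary" (Chelkak 2016, proof
of Lemma 2.14; Lawler–Schramm–Werner 2004, §5.2: "the maximum principle shows that `K'` is
connected"), used to steer the walls of the line's hub factorisation without planar topology.

* `exists_walk_superlevel` — let `C` be the set of sites joined to `v` by a `Gr`-walk inside the
  superlevel set `{z ∈ S | h v ≤ h z}`. If no site of `C` had a kept lattice edge to a site
  `w ∉ S` with `h w ≥ h v`, then at a maximiser `z⋆` of `h` on the finite set `C` harmonicity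
  forces all four lattice edges at `z⋆` to be kept with the value `h z⋆` at their far ends, which
  then lie in `S` and hence in `C`: the set of maximisers of `h` on `C` is nonempty and closed
  under the four lattice translations, impossible for a finite set (the maximiser-walks-east
  argument of the tree's `IsKilledSubharmonicOn.le_of_forall_boundary_le`).

Everything is proved; no definitions. Sources: D. Chelkak, *Robust discrete complex analysis: a
toolbox*, Ann. Probab. 44 (2016), Lemma 2.14 [Chelkak2016]; G. F. Lawler, O. Schramm, W. Werner,
*Conformal invariance of planar loop-erased random walks and uniform spanning trees*, Ann. Probab.
32 (2004), §5.2 [LawlerSchrammWerner2004].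
-/

noncomputable section

open scoped BigOperators Classical
open Finset Literature.Probability.LatticeModels

namespace Summit.CriticalPhenomena.SAWScalingLimit.Theorems.AvoidanceLimit.Anchor

/-- **Superlevel path to the boundary (maximum principle, path form).** Let `S ⊆ ℤ²` be finite,
`h` harmonic for the edge-killed walk of `Gr` on `S`, and `v ∈ S` with `0 < h v`. Then some site
`w` of the outer boundary of `S` for the killed walk has `h v ≤ h w` and is joined to `v` by a
`Gr`-walk every vertex of which is `w` or a site of `S` where `h ≥ h v`. Proof: with `C` the set of
sites joined to `v` by a `Gr`-walk inside `{z ∈ S | h v ≤ h z}` (finite, `∋ v`), if the conclusion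
failed then every kept lattice edge from `C` out of `S` would end strictly below `h v`; at a
maximiser `z⋆` of `h` on `C` the mean-value property `h z⋆ = ¼ ∑_e [kept] h (z⋆ + e)` with all
terms `≤ h z⋆` and `h z⋆ ≥ h v > 0` forces the four edges to be kept towards sites of value `h z⋆`,
which lie in `S` (else they would be `< h v`) and so in `C`; walking east from `z⋆` then never
leaves the finite set `C`, a contradiction. [cite: Chelkak2016, Lemma 2.14] -/
theorem exists_walk_superlevel :
    ∀ (Gr : SimpleGraph (Site 2)) (S : Set (Site 2)) (h : Site 2 → ℝ), S.Finite → IsKilledHarmonicOn Gr h S →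
      ∀ v ∈ S, 0 < h v → ∃ w ∈ killedOuterBoundary Gr S, h v ≤ h w ∧
        ∃ π : Gr.Walk v w, ∀ z ∈ π.support, z = w ∨ (z ∈ S ∧ h v ≤ h z) := by
  intro Gr S h hS H v hv hpos
  -- `C`: the sites joined to `v` by a `Gr`-walk inside the superlevel set `{z ∈ S | h v ≤ h z}`
  set C : Set (Site 2) := {z | ∃ π : Gr.Walk v z, ∀ y ∈ π.support, y ∈ S ∧ h v ≤ h y}
  have hvC : v ∈ C := ⟨SimpleGraph.Walk.nil, fun y hy => by
    rw [SimpleGraph.Walk.mem_support_nil_iff.1 hy]; exact ⟨hv, le_rfl⟩⟩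
  have hCS : ∀ z ∈ C, z ∈ S := fun z ⟨π, hπ⟩ => (hπ z π.end_mem_support).1
  have hCfin : C.Finite := hS.subset fun z hz => hCS z hz
  -- one more kept edge inside the superlevel set stays in `C`
  have hext : ∀ z ∈ C, ∀ w, Gr.Adj z w → w ∈ S → h v ≤ h w → w ∈ C := by
    rintro z ⟨π, hπ⟩ w hadj hwS hvw
    refine ⟨π.concat hadj, fun y hy => ?_⟩
    rw [SimpleGraph.Walk.support_concat, List.mem_append, List.mem_singleton] at hy
    rcases hy with hy | rfl
    · exact hπ y hy
    · exact ⟨hwS, hvw⟩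
  by_contra hcon
  -- under `hcon`, every kept lattice edge leaving `S` from a site of `C` ends strictly below `h v`
  have key : ∀ z ∈ C, ∀ e : SRW.Dir 2, Gr.Adj z (z + SRW.stepVec e) → z + SRW.stepVec e ∉ S →
      h (z + SRW.stepVec e) < h v := by
    rintro z ⟨π, hπ⟩ e hadj hwS
    by_contra hle
    push Not at hle
    refine hcon ⟨z + SRW.stepVec e, ⟨hwS, z, (hπ z π.end_mem_support).1, e, rfl, hadj⟩, hle,
      π.concat hadj, fun y hy => ?_⟩
    rw [SimpleGraph.Walk.support_concat, List.mem_append, List.mem_singleton] at hy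
    rcases hy with hy | hy
    · exact Or.inr (hπ y hy)
    · exact Or.inl hy
  -- a maximiser of `h` on the finite nonempty set `C`
  obtain ⟨v₀, hv₀C, hmax⟩ := Set.exists_max_image C h hCfin ⟨v, hvC⟩
  set M' := h v₀ with hM'
  have hvM' : h v ≤ M' := hmax v hvC
  have hM'pos : 0 < M' := hpos.trans_le hvM'
  -- at a maximiser in `C`, every lattice neighbour is a `Gr`-neighbour in `C` with the same value
  have step : ∀ z ∈ C, h z = M' → ∀ e : SRW.Dir 2,
      Gr.Adj z (z + SRW.stepVec e) ∧ z + SRW.stepVec e ∈ C ∧ h (z + SRW.stepVec e) = M' := by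
    intro z hz hzM e
    set t : SRW.Dir 2 → ℝ := fun e =>
      if Gr.Adj z (z + SRW.stepVec e) then h (z + SRW.stepVec e) else 0 with ht
    -- every term of the killed average at `z` is at most `M'`
    have hle : ∀ e ∈ (univ : Finset (SRW.Dir 2)), t e ≤ M' := fun e _ => by
      simp only [ht]
      split_ifs with he
      · by_cases h1 : z + SRW.stepVec e ∈ S
        · by_cases h2 : h v ≤ h (z + SRW.stepVec e)
          · exact hmax _ (hext z hz _ he h1 h2)
          · exact (not_le.1 h2).le.trans hvM'
        · exact (key z hz e he h1).le.trans hvM'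
      · exact hM'pos.le
    have hsub : M' ≤ 4⁻¹ * ∑ e, t e := by rw [← hzM]; exact (H z (hCS z hz)).le
    have hsum : ∑ e, t e ≤ ∑ _e : SRW.Dir 2, M' := Finset.sum_le_sum hle
    have hcard : ∑ _e : SRW.Dir 2, M' = 4 * M' := by
      simp only [Finset.sum_const, Finset.card_univ, SRW.card_dir, nsmul_eq_mul]; push_cast; ring
    have heq : ∑ e, t e = ∑ _e : SRW.Dir 2, M' := le_antisymm hsum (by rw [hcard]; linarith)
    have hte : t e = M' := (Finset.sum_eq_sum_iff_of_le hle).1 heq e (Finset.mem_univ e)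
    simp only [ht] at hte
    split_ifs at hte with he
    · refine ⟨he, ?_, hte⟩
      by_cases h1 : z + SRW.stepVec e ∈ S
      · exact hext z hz _ he h1 (hvM'.trans hte.ge)
      · exact absurd (key z hz e he h1) (not_lt.2 (hvM'.trans hte.ge))
    · exact absurd hte (by linarith)
  -- walk east from the maximiser forever inside the finite set `C`
  set e₀ : SRW.Dir 2 := (0, true)
  have ray : ∀ n : ℕ, v₀ + n • SRW.stepVec e₀ ∈ C ∧ h (v₀ + n • SRW.stepVec e₀) = M' := by
    intro n
    induction n with
    | zero => simp [hM', hv₀C]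
    | succ n ih =>
      rw [add_succ_nsmul_stepVec]
      obtain ⟨-, h2, h3⟩ := step _ ih.1 ih.2 e₀
      exact ⟨h2, h3⟩
  exact hCfin.not_infinite (Set.infinite_of_injective_forall_mem (add_nsmul_stepVec_injective v₀)
    fun n => (ray n).1)

end Summit.CriticalPhenomena.SAWScalingLimit.Theorems.AvoidanceLimit.Anchor

end
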